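/-
Origin: expansion seat `planner-pub-hodgecm-pv12-g5-0`, handover #1 2026-08-18T06:44:58Z (`HOME/pub-hodgecm-pv12-g5/lean/Pv12g5/FockUniqueness.lean`, md5 ab99488f, 714 lines);
landed by the gen-7 packager in gate run 25 as `HodgeCM/PerL34/FockUniqueness.lean` (verbatim).
-/
/-
Origin: HOME/pub-hodgecm-pv12-g5/lean/Pv12g5/FockUniqueness.lean — session planner-pub-hodgecm-pv12-g5-0 (unit
pub-hodgecm-pv12-g5, DAG-node prover #12 gen 5, the Fock-model seat).  Intended final place:
`HodgeCM/PerL34/FockUniqueness.lean` (namespace `HodgeCM.PerL34.Fock.Uniq`).  Imports the LANDED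
`HodgeCM.PerL34.FockLieModule` (pv05-g3, run 24) and Mathlib only — no `Pv12g5.*` import to rewrite; asserts nothing,
cites nothing (KERNEL).
-/
import Mathlib.Algebra.Lie.Semisimple.Defs
import Mathlib.LinearAlgebra.Eigenspace.Basic
import Summits.HodgeConjecture.HodgeCM.PerL34.FockLieModule

set_option autoImplicit false

/-!
# Uniqueness of irreducible lowest / highest weight `𝔤𝔩₃(ℂ)`-modules, and the external characterisation of the Fock pieces `F_k`

`FockLowestWeight` records that `z₂^k ∈ F_k` (resp. `w^m ∈ F_{-m}`) is a LOWEST weight vector of weight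
`(1, k+1, 0)` (resp. `(1, 1, -m)`) and `FockLieModule.fockPiece_isIrreducible` that each `F_k` is an irreducible
`𝔤𝔩₃(ℂ)`-Lie module — but the sentence "so `F_k` is THE irreducible lowest weight module of that lowest weight" was
left untyped there ("no Verma-module vocabulary").  This file types and proves it, for an ARBITRARY Lie module:

* `Uniq.IsExtremalVec a b c wt v` — for an ordered triple `a, b, c` exhausting the index type `ι` of
  `𝔤𝔩(ι, ℂ) = Matrix ι ι ℂ`: `v` is a weight vector (`⁅E_ii, v⁆ = wt i • v`) killed by the three matrix units
  `E_ba, E_ca, E_cb` going DOWN the order `a < b < c` (a lowest weight vector for the positive system `E_ab, E_bc,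
  E_ac`; taking the triple in the opposite order gives highest weight vectors);
* **`Uniq.nonempty_equiv_of_isExtremalVec`** — two IRREDUCIBLE Lie modules `M, N` over `Matrix ι ι ℂ`
  (`LieModule.IsIrreducible`) possessing nonzero extremal vectors of the SAME weight `wt` (for the same ordered
  triple) are isomorphic: `Nonempty (M ≃ₗ⁅ℂ, Matrix ι ι ℂ⁆ N)`.  Proof without Verma modules / PBW: the span of the
  raising words in `v` is the Lie submodule generated by `v` (`Uniq.wordSubmodule`), it is graded by
  `ad(E_aa - E_cc)` with the words of positive length in eigenvalues `≠` that of `v` (`Uniq.lie_H_word`), so a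
  vector of the generated module of `H`-eigenvalue `wt a - wt c` is a multiple of `v` (`Uniq.eq_smul_of_mem_wordSpan`);
  applied to `(x, y) ∈ M × N` this makes both projections of the module generated by `(x, y)` injective, and
  irreducibility makes them surjective (the classical "diagonal" argument);
* **`Uniq.nonempty_equiv_fockPiece_of_lowestWeight_zpow` / `_wpow`** — ANY irreducible `𝔤𝔩₃(ℂ)`-Lie module with
  a nonzero lowest weight vector of weight `(1, k+1, 0)` (resp. `(1, 1, -m)`) is isomorphic, as a Lie module, to
  `fockPiece k` (resp. `fockPiece (-m)`): the Fock pieces are characterised among all irreducible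
  `𝔤𝔩₃(ℂ)`-modules by their lowest `K`-type line, BY NAME in the kernel;
* `Uniq.exists_eq_smul_of_lie_H` — multiplicity one: in such a module every vector of the extremal `H`-eigenvalue
  is a multiple of the extremal vector;
* **`Uniq.nonempty_equiv_symPiece_of_highestWeight`** — the mirror statement for the definite pair, obtained from
  the SAME theorem by reading the index triple backwards: any irreducible `𝔤𝔩₃(ℂ)`-Lie module with a nonzero
  HIGHEST weight vector of weight `(d, 0, 0)` is isomorphic to `symPiece d = Sym^d ℂ³`.

Role in the cell (dictionary item (ii) of GAPS `pv05g3-K1`/`K3`, the S4 residual of the pv12 lineage): once a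
PRINTED source says that a representation contains an irreducible `(𝔤, K)`-submodule generated by a lowest weight
vector of weight `(1, k+1, 0)`, the identification of that submodule with `F_k` is no longer a dictionary sentence
but this theorem.  Nothing here is specific to the 2001 programme; no hypothesis beyond Mathlib typeclasses.

PACKAGER: no import rewrite needed; same file-local `attribute [local instance 100] LieRing.ofAssociativeRing` as
`FockGL3` / `FockLieModule` (Mathlib convention, `Mathlib.Algebra.Lie.Matrix`); the product Lie module structure on
`M × N` is a file-local instance (`Uniq.prodLieRingModule`), not global.
-/

namespace HodgeCM

namespace PerL34

namespace Fock

open scoped BigOperators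

attribute [local instance 100] LieRing.ofAssociativeRing

namespace Uniq

/-! ## 0. Two pieces of general Lie-module algebra Mathlib (at this version) does not provide -/

section General

variable {R : Type*} {L : Type*} {M : Type*} {N : Type*}
  [CommRing R] [LieRing L]
  [AddCommGroup M] [Module R M] [LieRingModule L M]
  [AddCommGroup N] [Module R N] [LieRingModule L N]

/-- A bijective morphism of Lie modules is an equivalence of Lie modules. -/
noncomputable def equivOfBijective (f : M →ₗ⁅R,L⁆ N) (hf : Function.Bijective f) : M ≃ₗ⁅R,L⁆ N :=
  { LinearEquiv.ofBijective (f : M →ₗ[R] N) hf with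
    toFun := f
    map_lie' := by intro x m; exact f.map_lie x m }

/-- The direct product `M × N` of two Lie modules (file-local instance). -/
@[reducible] def prodLieRingModule : LieRingModule L (M × N) where
  bracket x p := (⁅x, p.1⁆, ⁅x, p.2⁆)
  add_lie x y p := Prod.ext (add_lie x y p.1) (add_lie x y p.2)
  lie_add x p q := Prod.ext (lie_add x p.1 q.1) (lie_add x p.2 q.2)
  leibniz_lie x y p := Prod.ext (leibniz_lie x y p.1) (leibniz_lie x y p.2)

attribute [local instance] prodLieRingModule

/-- (Ported verbatim from the HodgeCMPerL package; no docstring in the source.) -/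
theorem prod_lie_fst (x : L) (p : M × N) : (⁅x, p⁆ : M × N).1 = ⁅x, p.1⁆ := rfl

/-- (Ported verbatim from the HodgeCMPerL package; no docstring in the source.) -/
theorem prod_lie_snd (x : L) (p : M × N) : (⁅x, p⁆ : M × N).2 = ⁅x, p.2⁆ := rfl

/-- (Ported verbatim from the HodgeCMPerL package; no docstring in the source.) -/
theorem prodLieModule [LieAlgebra R L] [LieModule R L M] [LieModule R L N] : LieModule R L (M × N) where
  smul_lie t x p := Prod.ext (smul_lie t x p.1) (smul_lie t x p.2)
  lie_smul t x p := Prod.ext (lie_smul t x p.1) (lie_smul t x p.2)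

attribute [local instance] prodLieModule

/-- the two projections and the first inclusion as morphisms of Lie modules -/
def fstHom : M × N →ₗ⁅R,L⁆ M :=
  { LinearMap.fst R M N with map_lie' := rfl }

/-- (Ported verbatim from the HodgeCMPerL package; no docstring in the source.) -/
def sndHom : M × N →ₗ⁅R,L⁆ N :=
  { LinearMap.snd R M N with map_lie' := rfl }

/-- (Ported verbatim from the HodgeCMPerL package; no docstring in the source.) -/
def inlHom : M →ₗ⁅R,L⁆ M × N :=
  { LinearMap.inl R M N with map_lie' := fun {x} {_} => Prod.ext rfl (lie_zero x).symm }

/-- (Ported verbatim from the HodgeCMPerL package; no docstring in the source.) -/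
def inrHom : N →ₗ⁅R,L⁆ M × N :=
  { LinearMap.inr R M N with map_lie' := fun {x} {_} => Prod.ext (lie_zero x).symm rfl }

/-- (Ported verbatim from the HodgeCMPerL package; no docstring in the source.) -/
@[simp] theorem fstHom_apply (p : M × N) : fstHom (R := R) (L := L) p = p.1 := rfl
/-- (Ported verbatim from the HodgeCMPerL package; no docstring in the source.) -/
@[simp] theorem sndHom_apply (p : M × N) : sndHom (R := R) (L := L) p = p.2 := rfl
/-- (Ported verbatim from the HodgeCMPerL package; no docstring in the source.) -/
@[simp] theorem inlHom_apply (m : M) : inlHom (R := R) (L := L) (N := N) m = (m, 0) := rfl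
/-- (Ported verbatim from the HodgeCMPerL package; no docstring in the source.) -/
@[simp] theorem inrHom_apply (n : N) : inrHom (R := R) (L := L) (M := M) n = (0, n) := rfl

end General

/-! ## 1. Matrix units of `𝔤𝔩(ι, ℂ)` and their commutators -/

section Units

variable {ι : Type*} [Fintype ι] [DecidableEq ι]

/-- the matrix unit `E_ij` -/
abbrev E (i j : ι) : Matrix ι ι ℂ := Matrix.single i j 1

/-- (Ported verbatim from the HodgeCMPerL package; no docstring in the source.) -/
theorem E_mul_E_same (i j k : ι) : E i j * E j k = E i k := by
  rw [Matrix.single_mul_single_same, mul_one]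

/-- (Ported verbatim from the HodgeCMPerL package; no docstring in the source.) -/
theorem E_mul_E_ne {i j k l : ι} (h : j ≠ k) : E i j * E k l = 0 := by
  unfold E
  rw [Matrix.single_mul_single_of_ne (h := h)]

/-- (Ported verbatim from the HodgeCMPerL package; no docstring in the source.) -/
theorem lie_E_E (i j k l : ι) :
    ⁅E i j, E k l⁆ = (if j = k then E i l else 0) - (if l = i then E k j else 0) := by
  rw [LieRing.of_associative_ring_bracket]
  congr 1
  · split_ifs with h
    · subst h; exact E_mul_E_same i j l
    · exact E_mul_E_ne h
  · split_ifs with h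
    · subst h; exact E_mul_E_same k l j
    · exact E_mul_E_ne h

/-- every matrix is a combination of matrix units -/
theorem eq_sum_smul_E (X : Matrix ι ι ℂ) : X = ∑ i, ∑ j, X i j • E i j := by
  conv_lhs => rw [Matrix.matrix_eq_sum_single X]
  refine Finset.sum_congr rfl fun i _ => Finset.sum_congr rfl fun j _ => ?_
  rw [Matrix.smul_single, smul_eq_mul, mul_one]

end Units

/-! ## 2. Extremal weight vectors and raising words in an arbitrary Lie module over `𝔤𝔩(ι, ℂ)` -/

section Words

variable {ι : Type*} [Fintype ι] [DecidableEq ι]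
variable {M : Type*} [AddCommGroup M] [Module ℂ M] [LieRingModule (Matrix ι ι ℂ) M]
  [LieModule ℂ (Matrix ι ι ℂ) M]

/-- `v` is an EXTREMAL weight vector of weight `wt` for the ordered triple `(a, b, c)`: an eigenvector of every
`E_ii` (eigenvalue `wt i`) killed by `E_ba`, `E_ca`, `E_cb`.  For `(a,b,c) = (1,2,3)` this is a lowest weight
vector (killed by the lowering operators `E₂₁, E₃₁, E₃₂`), for `(a,b,c) = (3,2,1)` a highest weight vector. -/
structure IsExtremalVec (a b c : ι) (wt : ι → ℂ) (v : M) : Prop where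
  diag : ∀ i, ⁅E i i, v⁆ = wt i • v
  kill_ba : ⁅E b a, v⁆ = 0
  kill_ca : ⁅E c a, v⁆ = 0
  kill_cb : ⁅E c b, v⁆ = 0

variable (a b c : ι)

/-- the raising words in `v`, graded by `ad(E_aa - E_cc)`-degree: `E_ab` and `E_bc` raise the degree by `1`,
`E_ac` by `2` -/
inductive IsWord (v : M) : ℕ → M → Prop
  | base : IsWord v 0 v
  | ab {d : ℕ} {w : M} : IsWord v d w → IsWord v (d + 1) ⁅E a b, w⁆
  | bc {d : ℕ} {w : M} : IsWord v d w → IsWord v (d + 1) ⁅E b c, w⁆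
  | ac {d : ℕ} {w : M} : IsWord v d w → IsWord v (d + 2) ⁅E a c, w⁆

/-- all raising words, and those of positive degree -/
def words (v : M) : Set M := {w | ∃ d, IsWord a b c v d w}

/-- (Ported verbatim from the HodgeCMPerL package; no docstring in the source.) -/
def wordsPos (v : M) : Set M := {w | ∃ d, IsWord a b c v (d + 1) w}

omit [Module ℂ M] [LieModule ℂ (Matrix ι ι ℂ) M] in
/-- (Ported verbatim from the HodgeCMPerL package; no docstring in the source.) -/
theorem words_eq_insert (v : M) : words a b c v = insert v (wordsPos a b c v) := by
  ext w
  constructor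
  · rintro ⟨d, hd⟩
    cases hd with
    | base => exact Set.mem_insert _ _
    | ab h => exact Set.mem_insert_of_mem _ ⟨_, IsWord.ab h⟩
    | bc h => exact Set.mem_insert_of_mem _ ⟨_, IsWord.bc h⟩
    | ac h => exact Set.mem_insert_of_mem _ ⟨_, IsWord.ac h⟩
  · rintro (rfl | ⟨d, hd⟩)
    · exact ⟨0, IsWord.base⟩
    · exact ⟨d + 1, hd⟩

/-- the span of the raising words -/
def wordSpan (v : M) : Submodule ℂ M := Submodule.span ℂ (words a b c v)

omit [LieModule ℂ (Matrix ι ι ℂ) M] in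
/-- (Ported verbatim from the HodgeCMPerL package; no docstring in the source.) -/
theorem self_mem_wordSpan (v : M) : v ∈ wordSpan a b c v := Submodule.subset_span ⟨0, IsWord.base⟩

omit [LieModule ℂ (Matrix ι ι ℂ) M] in
/-- (Ported verbatim from the HodgeCMPerL package; no docstring in the source.) -/
theorem word_mem_wordSpan {v : M} {d : ℕ} {w : M} (h : IsWord a b c v d w) : w ∈ wordSpan a b c v :=
  Submodule.subset_span ⟨d, h⟩

/-- an operator mapping words into the word span preserves the word span -/
theorem lie_mem_wordSpan_of_words {v : M} (X : Matrix ι ι ℂ)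
    (hX : ∀ d w, IsWord a b c v d w → ⁅X, w⁆ ∈ wordSpan a b c v) {w : M} (hw : w ∈ wordSpan a b c v) :
    ⁅X, w⁆ ∈ wordSpan a b c v := by
  induction hw using Submodule.span_induction with
  | mem u hu =>
    obtain ⟨d, hd⟩ := hu
    exact hX d u hd
  | zero => rw [lie_zero]; exact Submodule.zero_mem _
  | add u u' _ _ hu hu' => rw [lie_add]; exact Submodule.add_mem _ hu hu'
  | smul t u _ hu => rw [lie_smul]; exact Submodule.smul_mem _ t hu

/-- (Ported verbatim from the HodgeCMPerL package; no docstring in the source.) -/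
theorem lie_ab_mem_wordSpan {v w : M} (hw : w ∈ wordSpan a b c v) : ⁅E a b, w⁆ ∈ wordSpan a b c v :=
  lie_mem_wordSpan_of_words a b c _ (fun _ _ h => word_mem_wordSpan a b c (IsWord.ab h)) hw

/-- (Ported verbatim from the HodgeCMPerL package; no docstring in the source.) -/
theorem lie_bc_mem_wordSpan {v w : M} (hw : w ∈ wordSpan a b c v) : ⁅E b c, w⁆ ∈ wordSpan a b c v :=
  lie_mem_wordSpan_of_words a b c _ (fun _ _ h => word_mem_wordSpan a b c (IsWord.bc h)) hw

/-- (Ported verbatim from the HodgeCMPerL package; no docstring in the source.) -/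
theorem lie_ac_mem_wordSpan {v w : M} (hw : w ∈ wordSpan a b c v) : ⁅E a c, w⁆ ∈ wordSpan a b c v :=
  lie_mem_wordSpan_of_words a b c _ (fun _ _ h => word_mem_wordSpan a b c (IsWord.ac h)) hw

variable {a b c}

/-- **The word span is a Lie submodule** when `v` is extremal and `a, b, c` exhaust `ι`. -/
theorem lie_mem_wordSpan (hab : a ≠ b) (hbc : b ≠ c) (hac : a ≠ c) (huniv : ∀ i, i = a ∨ i = b ∨ i = c)
    {wt : ι → ℂ} {v : M} (hv : IsExtremalVec a b c wt v) (X : Matrix ι ι ℂ) {w : M}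
    (hw : w ∈ wordSpan a b c v) : ⁅X, w⁆ ∈ wordSpan a b c v := by
  -- the matrix units act on `v` inside the word span
  have hunit : ∀ i j : ι, ⁅E i j, v⁆ ∈ wordSpan a b c v := by
    intro i j
    rcases huniv i with rfl | rfl | rfl <;> rcases huniv j with rfl | rfl | rfl
    · rw [hv.diag]; exact Submodule.smul_mem _ _ (self_mem_wordSpan _ _ _ v)
    · exact word_mem_wordSpan _ _ _ (IsWord.ab IsWord.base)
    · exact word_mem_wordSpan _ _ _ (IsWord.ac IsWord.base)
    · rw [hv.kill_ba]; exact Submodule.zero_mem _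
    · rw [hv.diag]; exact Submodule.smul_mem _ _ (self_mem_wordSpan _ _ _ v)
    · exact word_mem_wordSpan _ _ _ (IsWord.bc IsWord.base)
    · rw [hv.kill_ca]; exact Submodule.zero_mem _
    · rw [hv.kill_cb]; exact Submodule.zero_mem _
    · rw [hv.diag]; exact Submodule.smul_mem _ _ (self_mem_wordSpan _ _ _ v)
  have hv' : ∀ Y : Matrix ι ι ℂ, ⁅Y, v⁆ ∈ wordSpan a b c v := by
    intro Y
    rw [eq_sum_smul_E Y, sum_lie]
    refine Submodule.sum_mem _ fun i _ => ?_
    rw [sum_lie]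
    refine Submodule.sum_mem _ fun j _ => ?_
    rw [smul_lie]
    exact Submodule.smul_mem _ _ (hunit i j)
  -- induction over words, for all `X` simultaneously
  have key : ∀ d u, IsWord a b c v d u → ∀ Y : Matrix ι ι ℂ, ⁅Y, u⁆ ∈ wordSpan a b c v := by
    intro d u hu
    induction hu with
    | base => exact hv'
    | ab _ ih =>
      intro Y
      rw [leibniz_lie]
      exact Submodule.add_mem _ (ih _) (lie_ab_mem_wordSpan a b c (ih Y))
    | bc _ ih =>
      intro Y
      rw [leibniz_lie]
      exact Submodule.add_mem _ (ih _) (lie_bc_mem_wordSpan a b c (ih Y))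
    | ac _ ih =>
      intro Y
      rw [leibniz_lie]
      exact Submodule.add_mem _ (ih _) (lie_ac_mem_wordSpan a b c (ih Y))
  exact lie_mem_wordSpan_of_words a b c X (fun d u hu => key d u hu X) hw

/-- the Lie submodule generated by an extremal vector = the span of its raising words -/
def wordSubmodule (hab : a ≠ b) (hbc : b ≠ c) (hac : a ≠ c) (huniv : ∀ i, i = a ∨ i = b ∨ i = c)
    {wt : ι → ℂ} {v : M} (hv : IsExtremalVec a b c wt v) : LieSubmodule ℂ (Matrix ι ι ℂ) M :=
  { wordSpan a b c v with
    lie_mem := fun {X} {_} hw => lie_mem_wordSpan hab hbc hac huniv hv X hw }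

/-- (Ported verbatim from the HodgeCMPerL package; no docstring in the source.) -/
theorem mem_wordSubmodule (hab : a ≠ b) (hbc : b ≠ c) (hac : a ≠ c) (huniv : ∀ i, i = a ∨ i = b ∨ i = c)
    {wt : ι → ℂ} {v : M} (hv : IsExtremalVec a b c wt v) (w : M) :
    w ∈ wordSubmodule hab hbc hac huniv hv ↔ w ∈ wordSpan a b c v := Iff.rfl

/-- it is the smallest Lie submodule containing `v` -/
theorem wordSubmodule_eq_lieSpan (hab : a ≠ b) (hbc : b ≠ c) (hac : a ≠ c)
    (huniv : ∀ i, i = a ∨ i = b ∨ i = c) {wt : ι → ℂ} {v : M} (hv : IsExtremalVec a b c wt v) :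
    wordSubmodule hab hbc hac huniv hv = LieSubmodule.lieSpan ℂ (Matrix ι ι ℂ) {v} := by
  apply le_antisymm
  · intro w hw
    rw [mem_wordSubmodule] at hw
    have hsub : words a b c v ⊆ (LieSubmodule.lieSpan ℂ (Matrix ι ι ℂ) {v} : Set M) := by
      rintro u ⟨d, hd⟩
      induction hd with
      | base => exact LieSubmodule.subset_lieSpan (Set.mem_singleton v)
      | ab _ ih => exact LieSubmodule.lie_mem _ ih
      | bc _ ih => exact LieSubmodule.lie_mem _ ih
      | ac _ ih => exact LieSubmodule.lie_mem _ ih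
    exact (Submodule.span_le.mpr hsub) hw
  · rw [LieSubmodule.lieSpan_le, Set.singleton_subset_iff]
    exact self_mem_wordSpan a b c v

/-- in an irreducible module a nonzero extremal vector generates everything -/
theorem wordSpan_eq_top [LieModule.IsIrreducible ℂ (Matrix ι ι ℂ) M] (hab : a ≠ b) (hbc : b ≠ c) (hac : a ≠ c)
    (huniv : ∀ i, i = a ∨ i = b ∨ i = c) {wt : ι → ℂ} {v : M} (hv : IsExtremalVec a b c wt v) (hv0 : v ≠ 0) :
    wordSpan a b c v = ⊤ := by
  have h := IsSimpleOrder.eq_bot_or_eq_top (wordSubmodule hab hbc hac huniv hv)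
  rcases h with h | h
  · exact absurd ((LieSubmodule.eq_bot_iff _).mp h v (self_mem_wordSpan a b c v)) hv0
  · ext w
    simp only [Submodule.mem_top, iff_true]
    have : w ∈ wordSubmodule hab hbc hac huniv hv := by rw [h]; exact LieSubmodule.mem_top w
    exact this

/-! ### the grading by `H = E_aa - E_cc` -/

/-- the grading element -/
abbrev H (a c : ι) : Matrix ι ι ℂ := E a a - E c c

/-- (Ported verbatim from the HodgeCMPerL package; no docstring in the source.) -/
theorem lie_H_E_ab (hab : a ≠ b) (hbc : b ≠ c) (hac : a ≠ c) : ⁅H a c, E a b⁆ = E a b := by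
  rw [sub_lie, lie_E_E, lie_E_E]
  simp [hab.symm, hbc, hac.symm]

/-- (Ported verbatim from the HodgeCMPerL package; no docstring in the source.) -/
theorem lie_H_E_bc (hab : a ≠ b) (hbc : b ≠ c) (hac : a ≠ c) : ⁅H a c, E b c⁆ = E b c := by
  rw [sub_lie, lie_E_E, lie_E_E]
  simp [hab, hbc.symm, hac.symm]

/-- (Ported verbatim from the HodgeCMPerL package; no docstring in the source.) -/
theorem lie_H_E_ac (hac : a ≠ c) : ⁅H a c, E a c⁆ = (2 : ℂ) • E a c := by
  rw [sub_lie, lie_E_E, lie_E_E, two_smul]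
  simp [hac.symm]

/-- a raising word of degree `d` in an extremal vector of weight `wt` has `H`-eigenvalue `wt a - wt c + d` -/
theorem lie_H_word (hab : a ≠ b) (hbc : b ≠ c) (hac : a ≠ c) {wt : ι → ℂ} {v : M}
    (hv : IsExtremalVec a b c wt v) {d : ℕ} {w : M} (hw : IsWord a b c v d w) :
    ⁅H a c, w⁆ = (wt a - wt c + d) • w := by
  induction hw with
  | base => rw [sub_lie, hv.diag, hv.diag, Nat.cast_zero, add_zero, sub_smul]
  | ab _ ih =>
    rw [leibniz_lie, lie_H_E_ab hab hbc hac, ih, lie_smul, Nat.cast_succ, ← add_assoc, add_smul _ (1 : ℂ), one_smul,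
      add_comm]
  | bc _ ih =>
    rw [leibniz_lie, lie_H_E_bc hab hbc hac, ih, lie_smul, Nat.cast_succ, ← add_assoc, add_smul _ (1 : ℂ), one_smul,
      add_comm]
  | ac _ ih =>
    rw [leibniz_lie, lie_H_E_ac hac, smul_lie, ih, lie_smul, Nat.cast_add, Nat.cast_two, ← add_assoc,
      add_smul _ (2 : ℂ), add_comm]


-- port_pkg: scope closed for this part
end Words
end Uniq
end Fock
end PerL34
end HodgeCM
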